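import Summits.ResolutionOfSingularities.ResolutionOfSingularities.Theorems.FrobeniusClosingSteerWords23HeightSplitH
import Summits.ResolutionOfSingularities.ResolutionOfSingularities.Theorems.FrobeniusClosingSteerOddBranchPersistence

/-!
# Crux `Steer` (stmt-ResolutionOfSingularities-16345), line `switching-dichotomy` — WORDS 26: §σ2.27 v1.2 (the σ-residual batch r36: F-A1/F-A2/F-B words by name, the (Par) persistence fork of F-B-wild — candidate words — and the slate9 candidate §σ2.27b) (HOIST of the registered skeleton r52 5a09c4c2f84a0135, l.905–1221, inside `section HeightSplitTwo` with its `variable {K : Type} [Field K]`)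

Holder res-L0-w41-lead-1 g6 on res-L0-w41-plan-1 RULING 47 (E1) / 104b; see `…Words01Core` for the hoist protocol (bodies byte for byte;
`[cite: …]` / `[folklore]` tags on CLOSED `def … : Prop` words are written «(ref. …)» / «(folklore)» — GATE NOTE of `…Words02Stubs`;
cite keys inside `[cite:]` tags normalised to `references.bib` keys where needed, as in `…Words03Phases`).
Nothing here is a statement of the manuscript [claim: Hironaka2017, status: under-review]. OURS (candidates / vocabulary; AI review is
weaker than expert review).
-/

open Summit.ResolutionOfSingularities.ResolutionOfSingularities.Theses.FrobeniusClosing (IsolatedForcedTermination)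
open Literature.AlgebraicGeometry.Resolution (IsAbhyankarPlace FGOver exists_ringKrullDim_eq_and_trdeg_eq
  trdeg_eq_trdeg_of_isFractionRing locAtCentre IsQuadraticTransformAlong SubringDominates IsRsopPart
  LocalUniformization3 RelLocalUniformization CossartPiltant2019General)
open Summit.ResolutionOfSingularities.ResolutionOfSingularities.Theorems.SteerRankThinness
  (HasProperCoarsening concl_of_hasProperCoarsening rankOne_of_not_hasProperCoarsening)
open Summit.ResolutionOfSingularities.ResolutionOfSingularities.Theorems.PfaffLine

set_option linter.dupNamespace false

namespace Summit.ResolutionOfSingularities.ResolutionOfSingularities.Theorems.SwitchingDichotomy.Words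

section SteeredTwo

open IsLocalRing
open Literature.AlgebraicGeometry.Resolution (IsLocalBlowupAlong IsQuadraticTransform IsExcellentRing)

variable {K : Type} [Field K]


/-! #### §σ2.27 v1.2 (r36 batch, plan-1 RULING 94 «DEFERRED TO r36»; drafted on the r35 reference combo 3309bc7868463cab = r34 + §σ2.26 v2 bca5ec6519acfa2f +
res-type-096's leaves c470fc1802e8c3bc; res-L0-w41-strat-2)

(1) **N1 ADOPTED — the FRONTIER / RUNG binders SPECIALISED to `p = 2`** (tri-2 v10 PART 2 N1; weaker words, same T-line; research hands owe
characteristic 2 only): hS2 ↦ `NoEternalStrippedRadicandChainH 2 2` (Lipman leaf at `p = 2`), hS3 ↦ `NoEternalStrippedRadicandChainH 2 3` ⟸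
G-perf(3, 2e) ∧ W(3, 2e) (`e ≥ 2`, i.e. every EVEN `d ≥ 4`), F-B♮ ⟸ Θ♮ ∧ G-TAME(4, 2e); the height split is re-run VERBATIM with the two K♭
binders at `p = 2` (`highWanderConclTwoN_of_heightSplitH₂`: the run's `p = 2` is substituted at the two use sites), and
**`eternalSteeredRunTwo_of_slate8`** is the T-line candidate for r36: slate7 with `hG4 : ∀ e, 2 ≤ e → …Perfect 2 4 (2*e)`,
`hG3 : ∀ e, 2 ≤ e → …Perfect 2 3 (2*e)`, `hW3 : ∀ e, 2 ≤ e → …Imperfect 2 3 (2*e)` and (B2)/(C) fed by res-type-096's `derivationStepTransfer_holds` /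
`cleaningExact_holds` — 12 binders: FRONTIER {F-A1 `hB₂`, F-A2 `hC₂`, F-B-wild `hFBw`, G-TAME(4)₂ `hG4`, W(3)₂ `hW3`} · RUNG {G-perf(3)₂ `hG3`} ·
WORK {Θ♮ `hΘ`, Θ1♭+(L7) `hA3`, D3a `hD3a`, D3c `hD3c` (= res-type-062's `lowTowerTamingTwo_holds` at r35, RULING 92)} · FACTS {hL′, hCP′}.
(2) **(Par) PERSISTENCE FORK of F-B-wild — CANDIDATE words** (RULING 93a / tri-1 PREREG-FB v1.6 D·S6; interface to be CONFIRMED by tri-1 / tri-3 R-Q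
before adoption): `StrippingTailWildConclTwoN` ⟸ `StrippingTailPersistentConclTwoN` (v1.2, tri-1 11:07:24Z: the tail has ONE `x ∈ 𝔪_O ∖ 0` such that
every late `y ∈ 𝔪_O ∩ R i` becomes divisible by `x` in SOME LATER member `R j`, `j > i` — VERBATIM the WEAK hypothesis `h` of tri-1's kernel file
`v69/VFree.lean` v2.1 427d134263c9583b (`valuation_eq_pow_of_persistent'` / `discrete_of_persistent'`); = tri-1's (P3) object «x persists» read across strips; its emptiness is (P4)–(P5): V-free squeeze ⇒ proper coarsening
(res-type-038 `hasProperCoarsening_of_forall_pow_dvd`) or `Γ` cyclic ⇒ `Discrete` — both excluded by `CoreDatum`; WORK-sized) ∧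
`StrippingTailSwitchingConclTwoN` (no eternal exceptional parameter: the FRONTIER residual ⊇ branch (M) «loop III»; tri-1's (P1)–(P3) say branch (O)
lands in the persistent half, so (Par-O) = (P1)–(P3) + Persistent). Pure-logic fork PROVED; NOT on slate8 (asides until confirmed).
(3) Claim B (RULING 86c/87c; idea-3 card 5, tri-3 R-P «m̄ > m at a switch ⇒ f⁺ ∈ (x̃, ε)² ⇒ permissible surface ⇒ no point step») is NOT typed here:
its hypotheses live in idea-3's coordinates (m, m̄, the switch) which have no words yet — booked for idea-3 g5 / §σ2.28 (GAP G1 first). OURS; candidates. -/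

/-- **hS3 at `p = 2` from the `p = 2` pieces**: K♭ v2.2 (2, 3) ⟸ G-perf(3, 2e) ∧ W(3, 2e), `e ≥ 2` ((B2), (C) by res-type-096's leaves). Pure logic.
OURS. [folklore] -/
theorem noEternalStrippedRadicandChainH_two_three_of_pieces
    (hG3 : ∀ e : ℕ, 2 ≤ e → NoEternalConstOrderIsolatedChainPerfect 2 3 (2 * e))
    (hW3 : ∀ e : ℕ, 2 ≤ e → NoEternalConstOrderIsolatedChainImperfect 2 3 (2 * e)) :
    NoEternalStrippedRadicandChainH 2 3 :=
  noEternalStrippedRadicandChainH_of_constOrder Nat.prime_two (by norm_num) (derivationStepTransfer_holds 2 3)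
    (cleaningExact_holds 2 3) fun e he => noEternalConstOrderIsolatedChain_of_perfect_of_imperfect (hG3 e he) (hW3 e he)

/-- **hS2 at `p = 2`** from the Lipman leaf of record. OURS. [folklore] -/
theorem noEternalStrippedRadicandChainH_two_two_of_lipmanNormalised
    (hL' : Literature.AlgebraicGeometry.Resolution.Lipman1978NoEternalNormalisedBranch.{0}) :
    NoEternalStrippedRadicandChainH 2 2 :=
  noEternalStrippedRadicandChainH_of (noEternalStrippedRadicandChain_two_of_lipmanNormalised hL' 2 Nat.prime_two)

/-- **K♭ v2.2-perfect (2, 4) ⟸ G-TAME(4, 2e)**, `e ≥ 2`. Pure logic. OURS. [folklore] -/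
theorem noEternalStrippedRadicandChainHP_two_four_of_pieces
    (hG4 : ∀ e : ℕ, 2 ≤ e → NoEternalConstOrderIsolatedChainPerfect 2 4 (2 * e)) :
    NoEternalStrippedRadicandChainHP 2 4 :=
  noEternalStrippedRadicandChainHP_of_constOrder Nat.prime_two (by norm_num) (derivationStepTransfer_holds 2 4)
    (cleaningExact_holds 2 4) hG4

/-- F-B♮ ⟸ Θ♮ ∧ K♭ v2.2-perfect (2, 4) (the run's `p = 2` substituted). Pure logic. OURS. [folklore] -/
theorem strippingTailIsolatedConclTwoN_of_chain₂ (hΘ : PointTailChainTwoN)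
    (hK4 : NoEternalStrippedRadicandChainHP 2 4) : StrippingTailIsolatedConclTwoN := by
  intro p hp2 k K _ _ _ _ _ O A₀ h₀ t core hrk R P s hR0 hN hrun hnd hhigh h2 hinf hiso
  subst hp2
  exact hΘ 2 rfl k K O A₀ h₀ t core hrk R P s hR0 hN hrun hnd hhigh h2 hinf hiso hK4

/-- **F-B ⟸ Θ♮ ∧ G-TAME(4, 2e) (e ≥ 2) ∧ F-B-wild** — the shape slate8 consumes. Pure logic. OURS. [folklore] -/
theorem strippingTailHighConclTwoN_of_pieces₂ (hΘ : PointTailChainTwoN)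
    (hG4 : ∀ e : ℕ, 2 ≤ e → NoEternalConstOrderIsolatedChainPerfect 2 4 (2 * e))
    (hW : StrippingTailWildConclTwoN) : StrippingTailHighConclTwoN :=
  strippingTailHighConclTwoN_of_fork
    (strippingTailIsolatedConclTwoN_of_chain₂ hΘ (noEternalStrippedRadicandChainHP_two_four_of_pieces hG4)) hW

/-- **THE HEIGHT SPLIT with the K♭ binders at `p = 2`** — `highWanderConclTwoN_of_heightSplitH` VERBATIM except `hS2 : K♭H 2 2`, `hS3 : K♭H 2 3`
and `subst hp2` at their two use sites. PROVED. OURS. [folklore] -/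
theorem highWanderConclTwoN_of_heightSplitH₂ (hS : StrippingTailHighConclTwoN) (hB₂ : BirthWanderHighConclTwoN)
    (hC₂ : BranchWanderHighConclTwoN) (hA3 : StrippedThreadTwoNH) (hTi : FinitelyHitThreadTwoN) (hH : HitHeightLtTwoN)
    (hK1 : ∀ p : ℕ, p.Prime → NoEternalIsolatedRadicandChain p 1)
    (hK2 : ∀ p : ℕ, p.Prime → NoEternalIsolatedRadicandChain p 2)
    (hK3 : ∀ p : ℕ, p.Prime → NoEternalIsolatedRadicandChain p 3)
    (hS2 : NoEternalStrippedRadicandChainH 2 2)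
    (hS3 : NoEternalStrippedRadicandChainH 2 3) : HighWanderConclTwoN := by
  intro p hp2 k K _i1 _i2 _i3 _i4 _i5 O A₀ h₀ t core hrk R P s hR0 hN hrun hnd hio hhigh
  have hp : p.Prime := hp2 ▸ Nat.prime_two
  -- infinitely many positive steps
  have hinf : {j | IsPosStep R P j}.Infinite := by
    refine Set.infinite_of_not_bddAbove ?_
    rintro ⟨b, hb'⟩
    obtain ⟨i, hi, hnp⟩ := hio (b + 1)
    obtain ⟨hl, -⟩ := hrun.2 i
    have := hb' (show i ∈ {j | IsPosStep R P j} from ⟨hl, fun h => hnp ⟨hl, h⟩⟩)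
    omega
  by_cases h2 : HeightTwoStepsInfinite R P
  swap
  · exact hS p hp2 k K O A₀ h₀ t core hrk R P s hR0 hN hrun hnd hhigh h2 hinf
  by_cases hb : {j | IsRootStep R P j ∧ 2 ≤ (P j).height}.Infinite
  · exact hB₂ p hp2 k K O A₀ h₀ t core hrk R P s hR0 hN hrun hnd hhigh hb
  by_cases hc : ∃ i, 2 ≤ (P i).height ∧ {j | IsChildStep R P i j}.Infinite
  · exact hC₂ p hp2 k K O A₀ h₀ t core hrk R P s hR0 hN hrun hnd hhigh hc
  exfalso
  have hroots : {j | IsRootStep R P j ∧ 2 ≤ (P j).height}.Finite := Set.not_infinite.mp hb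
  have hbr : ∀ i, 2 ≤ (P i).height → {j | IsChildStep R P i j}.Finite := fun i hi =>
    Set.not_infinite.mp fun h => hc ⟨i, hi, h⟩
  have hmono : Monotone R := hrun.monotone
  obtain ⟨hle3, hhit⟩ := hH p hp2 k K O A₀ h₀ t core hrk R P s hR0 hN hrun
  -- descent on the height `h ≥ 2` carrying infinitely many positive steps
  have main : ∀ h : ℕ, 2 ≤ h → {j | IsPosStep R P j ∧ (P j).height = (h : ℕ∞)}.Infinite → False := by
    intro h
    induction h using Nat.strong_induction_on with
    | _ h ih =>
      intro h2le hinfh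
      have h2le' : (2 : ℕ∞) ≤ (h : ℕ∞) := by exact_mod_cast h2le
      -- localised graded König at height `h`
      obtain ⟨J, hJ, hA, hh⟩ := wanderForestKoenig_graded' R P hmono h hinfh
        (hroots.subset fun j hj => ⟨hj.1, by rw [Set.mem_setOf_eq] at hj; rw [hj.2]; exact h2le'⟩)
        (fun i hi => hbr i (by rw [hi]; exact h2le'))
      have hJ2 : ∀ j ∈ J, 2 ≤ (P j).height := fun j hj => by rw [hh j hj]; exact h2le'
      by_cases hfin : IsFinitelyHit R P J
      · obtain ⟨c, hc1, hc3, hK⟩ := hTi p hp2 k K O A₀ h₀ t core hrk R P s hR0 hN hrun J hJ hA hfin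
        interval_cases c
        · exact hK (hK1 p hp)
        · exact hK (hK2 p hp)
        · exact hK (hK3 p hp)
      by_cases hfin2 : IsFinitelyHitTwo R P J
      · obtain ⟨c, hc2, hc3, hK⟩ :=
          hA3 p hp2 k K O A₀ h₀ t core hrk R P s hR0 hN hrun hnd hhigh J hJ hA hJ2 hfin2 hfin
        interval_cases c
        · exact hK (by subst hp2; exact hS2)
        · exact hK (by subst hp2; exact hS3)
      -- infinitely many hits of height `≥ 2`: positive steps of height in `[2, h)`
      obtain ⟨j₀, hj₀⟩ := hJ.nonempty
      have hH' : {m | IsPosStep R P m ∧ 2 ≤ (P m).height ∧ (P m).height < (h : ℕ∞)}.Infinite := by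
        refine Set.infinite_of_not_bddAbove ?_
        rintro ⟨b, hb⟩
        apply hfin2
        refine ⟨max b j₀ + 1, fun m hm _ j hj hmj => ?_⟩
        have hj₀m : j₀ < m := by omega
        have hA₀ : IsAncestorStep R P j₀ j := hA j₀ hj₀ j hj (lt_trans hj₀m hmj.1.1)
        obtain ⟨hpos, hlt⟩ := hhit j₀ m j hA₀ hj₀m hmj.1
        have hmb : m ≤ b := hb ⟨hpos, hmj.2, lt_of_lt_of_eq hlt (hh j hj)⟩
        omega
      obtain ⟨h', hh'n, hinf'⟩ :=
        exists_fibre_infinite_of_lt (fun m => (P m).height) h hH' fun m hm => hm.2.2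
      obtain ⟨m₁, hm₁⟩ := hinf'.nonempty
      have h2' : 2 ≤ h' := by
        have h1 : (2 : ℕ∞) ≤ (h' : ℕ∞) := by
          have h3 := hm₁.1.2.1
          rw [show (P m₁).height = (h' : ℕ∞) from hm₁.2] at h3
          exact h3
        exact_mod_cast h1
      exact ih h' hh'n h2' (hinf'.mono fun m hm => ⟨hm.1.1, hm.2⟩)
  -- start of the descent: pigeonhole on the positive steps of height `≥ 2` (heights `≤ 3 < 4`, Θ2 (a))
  obtain ⟨h₀, -, hinf₀⟩ := exists_fibre_infinite_of_lt (fun m => (P m).height) 4 h2 fun m hm =>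
    lt_of_le_of_lt (hle3 m hm.1) (by exact_mod_cast (by norm_num : (3 : ℕ) < 4))
  obtain ⟨m₁, hm₁⟩ := hinf₀.nonempty
  have h2₀ : 2 ≤ h₀ := by
    have h1 : (2 : ℕ∞) ≤ (h₀ : ℕ∞) := by
      have h3 := hm₁.1.2
      rw [show (P m₁).height = (h₀ : ℕ∞) from hm₁.2] at h3
      exact h3
    exact_mod_cast h1
  exact main h₀ h2₀ (hinf₀.mono fun m hm => ⟨hm.1.1, hm.2⟩)


/-- Debts form at `p = 2`. Pure logic. OURS. [folklore] -/
theorem highWanderConclTwoN_of_heightSplit_debtsH₂ (hS : StrippingTailHighConclTwoN) (hB₂ : BirthWanderHighConclTwoN)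
    (hC₂ : BranchWanderHighConclTwoN) (hA3 : StrippedThreadTwoNH) (hTi : FinitelyHitThreadTwoN) (hH : HitHeightLtTwoN)
    (hL : Literature.AlgebraicGeometry.Resolution.Lipman1978NoEternalNormalBranch.{0})
    (hCP' : Literature.AlgebraicGeometry.Resolution.CossartPiltant2019LocalPermissible.{0})
    (hS2 : NoEternalStrippedRadicandChainH 2 2) (hS3 : NoEternalStrippedRadicandChainH 2 3) : HighWanderConclTwoN :=
  highWanderConclTwoN_of_heightSplitH₂ hS hB₂ hC₂ hA3 hTi hH noEternalIsolatedRadicandChain_one_holds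
    (noEternalIsolatedRadicandChain_two_of_lipman hL) (noEternalIsolatedRadicandChain_three_of_CP' hCP') hS2 hS3

/-- `eternalSteeredRunTwo_of_slate2H` with the K♭ binders at `p = 2`. Pure logic. OURS. [folklore] -/
theorem eternalSteeredRunTwo_of_slate2H₂ (hN1 : NormalAtGeneratorTwo) (hB4 : NoHeightOneCarrierTwo)
    (hTi : FinitelyHitThreadTwoN) (hH : HitHeightLtTwoN)
    (hS : StrippingTailHighConclTwoN) (hB₂ : BirthWanderHighConclTwoN) (hC₂ : BranchWanderHighConclTwoN)
    (hA3 : StrippedThreadTwoNH)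
    (hS2 : NoEternalStrippedRadicandChainH 2 2) (hS3 : NoEternalStrippedRadicandChainH 2 3)
    (hLow : Literature.AlgebraicGeometry.Resolution.Lipman1978ValuativeQuadraticSequence.{0} → LowOrderTailConclTwoN)
    (hL : Literature.AlgebraicGeometry.Resolution.Lipman1978NoEternalNormalBranch.{0})
    (hLV : Literature.AlgebraicGeometry.Resolution.Lipman1978ValuativeQuadraticSequence.{0})
    (hCP' : Literature.AlgebraicGeometry.Resolution.CossartPiltant2019LocalPermissible.{0}) : EternalSteeredRunTwo :=
  eternalSteeredRunTwo_of_normalised_split_debts (normalisedStartTwo_of_normalAtGenerator hN1)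
    (pointTailHighConclTwo_of_B4 hB4)
    (highWanderConclTwoN_of_heightSplit_debtsH₂ hS hB₂ hC₂ hA3 hTi hH hL hCP' hS2 hS3) (hLow hLV) hL
    (_root_.Summit.ResolutionOfSingularities.ResolutionOfSingularities.Theorems.SwitchingDichotomy.HironakaLUBranchOfCP.hironakaLUIsolatedBranch_of_localPermissible hCP')

/-- **T-LINE CANDIDATE slate8 (r36)** — slate7 with the FRONTIER / RUNG binders at `p = 2` (RULING 94 N1) and (B2)/(C) fed by res-type-096's leaves:
T ⇐ FRONTIER {F-A1 `hB₂` · F-A2 `hC₂` · F-B-wild `hFBw` · G-TAME(4)₂ `hG4` · W(3)₂ `hW3`} · RUNG {G-perf(3)₂ `hG3` (idea-3)} · WORK {Θ♮ `hΘ` ·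
Θ1♭+(L7) `hA3 : StrippedThreadTwoNH` (pv-003 `strippedThreadTwoNH_holds`, pv-004 (L7)) · D3a `hD3a` (pv-012) · D3c `hD3c` (res-type-062
`lowTowerTamingTwo_holds` at r35 — feed by name at paste)} · FACTS {Lipman 1978 (A) `hL'`, Cossart–Piltant 2019 `hCP'`}. 12 binders. The holder decides.
Pure logic. OURS. [folklore] -/
theorem eternalSteeredRunTwo_of_slate8
    (hΘ : PointTailChainTwoN) (hFBw : StrippingTailWildConclTwoN)
    (hB₂ : BirthWanderHighConclTwoN) (hC₂ : BranchWanderHighConclTwoN)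
    (hA3 : StrippedThreadTwoNH)
    (hG4 : ∀ e : ℕ, 2 ≤ e → NoEternalConstOrderIsolatedChainPerfect 2 4 (2 * e))
    (hG3 : ∀ e : ℕ, 2 ≤ e → NoEternalConstOrderIsolatedChainPerfect 2 3 (2 * e))
    (hW3 : ∀ e : ℕ, 2 ≤ e → NoEternalConstOrderIsolatedChainImperfect 2 3 (2 * e))
    (hD3a : LowTowerExistsTwo) (hD3c : LowTowerTamingTwo)
    (hL' : Literature.AlgebraicGeometry.Resolution.Lipman1978NoEternalNormalisedBranch.{0})
    (hCP' : Literature.AlgebraicGeometry.Resolution.CossartPiltant2019LocalPermissible.{0}) : EternalSteeredRunTwo :=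
  eternalSteeredRunTwo_of_slate2H₂ normalAtGeneratorTwo_holds noHeightOneCarrierTwo_holds finitelyHitThreadTwoN_holds hitHeightLtTwoN_holds
    (strippingTailHighConclTwoN_of_pieces₂ hΘ hG4 hFBw) hB₂ hC₂ hA3
    (noEternalStrippedRadicandChainH_two_two_of_lipmanNormalised hL')
    (noEternalStrippedRadicandChainH_two_three_of_pieces hG3 hW3)
    (lowOrderTailConclTwoN_of_lipman lowOrderStep_holds
      (lowRunTamedMixedBranchTwo_of_pieces' lowSurfaceStepExitsTwo_holds hD3a lowTowerPointStepsIOTwo_holds hD3c lowTowerSingularTwo_holds)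
      tamedMixedBranchReduction_holds)
    hL'.toNormalBranch hL'.toValuativeQuadraticSequence hCP'

/-! ##### (Par) persistence fork of F-B-wild — CANDIDATE words (RULING 93a; tri-1 PREREG-FB v1.6 D·S6 (P3)–(P5)); asides until tri-1 / tri-3 confirm -/

/-- **(Par-P) · StrippingTailPersistentConclTwoN** (CANDIDATE WORK word): F-B-wild's binders + «some `x ∈ 𝔪_O ∖ 0` has
`∀ i ≥ i₀, ∀ y ∈ R i, v y < 1 → ∃ j > i, y / x ∈ R j`» (v1.2: VERBATIM the WEAK hypothesis `h` of tri-1's `VFree.lean` v2.1 427d134263c9583b, asked for by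
tri-1 11:07:24Z — the consecutive form fails at strip stages, where `R (i+1) = R i`; = «the exceptional parameter `x` PERSISTS», tri-1 (P3)) ⇒ `Concl`.
Mechanism (tri-1 (P4)–(P5), KERNEL in VFree.lean: `valuation_eq_pow_of_persistent'`, `discrete_of_persistent'`, Frobenius `pow_char_eq_div_of_frac` with `N = 2`): `∀ m, x^m ∣ g` ⇒ `HasProperCoarsening O`
(res-type-038 p524271), else `Γ ⊆ v(x)^ℤ` up to index 2 ⇒ `Discrete O` — both excluded by `CoreDatum`; the supplier threads `hRO : ∀ i, R i ≤ O`
and the torsor fraction field from the run. Branch (O) of tri-1's anatomy lands here by (P1)–(P3). WORK-sized. OURS. (folklore) -/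
def StrippingTailPersistentConclTwoN : Prop :=
  ∀ p : ℕ, p = 2 →
    ∀ (k K : Type) [Field k] [CharP k p] [PerfectField k] [Field K] [Algebra k K]
    (O : ValuationSubring K) (A₀ : Subalgebra k K) (h₀ : A₀.toSubring ≤ O.toSubring) (t : K),
    CoreDatum p 4 k K O A₀ h₀ t → ¬ HasProperCoarsening O →
    ∀ (R : ℕ → Subring K) (P : (i : ℕ) → Ideal (R i)) (s : ℕ → K),
      R 0 = locAtCentre A₀.toSubring O → NormalAt O (R 0) p t → IsSteeredRun O R P t p s →
      (¬ ∃ i₀ c : ℕ, 1 ≤ c ∧ IsDominantTail R P i₀ c) →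
      (∃ i₀ : ℕ, ∀ i, i₀ ≤ i → IsHighOrderAt R s p i) →
      ¬ HeightTwoStepsInfinite R P → {j | IsPosStep R P j}.Infinite →
      (∀ i₀ : ℕ, ∃ i, i₀ ≤ i ∧ IsPointStep R P i ∧
        ∀ hs : s i ^ p ∈ R i, ¬ HasIsolatedSingularity (RadicandRing (R i) p ⟨s i ^ p, hs⟩)) →
      (∃ i₀ : ℕ, ∃ x : K, x ≠ 0 ∧ x ∈ O ∧ O.valuation x < 1 ∧
        ∀ i, i₀ ≤ i → ∀ y ∈ R i, O.valuation y < 1 → ∃ j, i < j ∧ y / x ∈ R j) →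
      Concl O A₀ t

/-- **(Par-S) · StrippingTailSwitchingConclTwoN** (CANDIDATE FRONTIER residual ⊇ branch (M) «loop III»): F-B-wild's binders + the NEGATION of (Par-P)'s
persistence clause (for every `x` and every `i₀` some late `y ∈ 𝔪_O ∩ R i` is NEVER divisible by `x` in a later member: the exceptional parameter SWITCHES
infinitely often) ⇒ `Concl`. idea-1 g8's K4 object (RULING 81b); tri-1's
bench b4 `f = x(y² + zw)`. OURS. (folklore) -/
def StrippingTailSwitchingConclTwoN : Prop :=
  ∀ p : ℕ, p = 2 →
    ∀ (k K : Type) [Field k] [CharP k p] [PerfectField k] [Field K] [Algebra k K]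
    (O : ValuationSubring K) (A₀ : Subalgebra k K) (h₀ : A₀.toSubring ≤ O.toSubring) (t : K),
    CoreDatum p 4 k K O A₀ h₀ t → ¬ HasProperCoarsening O →
    ∀ (R : ℕ → Subring K) (P : (i : ℕ) → Ideal (R i)) (s : ℕ → K),
      R 0 = locAtCentre A₀.toSubring O → NormalAt O (R 0) p t → IsSteeredRun O R P t p s →
      (¬ ∃ i₀ c : ℕ, 1 ≤ c ∧ IsDominantTail R P i₀ c) →
      (∃ i₀ : ℕ, ∀ i, i₀ ≤ i → IsHighOrderAt R s p i) →
      ¬ HeightTwoStepsInfinite R P → {j | IsPosStep R P j}.Infinite →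
      (∀ i₀ : ℕ, ∃ i, i₀ ≤ i ∧ IsPointStep R P i ∧
        ∀ hs : s i ^ p ∈ R i, ¬ HasIsolatedSingularity (RadicandRing (R i) p ⟨s i ^ p, hs⟩)) →
      (¬ ∃ i₀ : ℕ, ∃ x : K, x ≠ 0 ∧ x ∈ O ∧ O.valuation x < 1 ∧
        ∀ i, i₀ ≤ i → ∀ y ∈ R i, O.valuation y < 1 → ∃ j, i < j ∧ y / x ∈ R j) →
      Concl O A₀ t

/-- F-B-wild ⟸ (Par-P) ∧ (Par-S). Pure logic, PROVED. OURS. [folklore] -/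
theorem strippingTailWildConclTwoN_of_persistence_fork (hP : StrippingTailPersistentConclTwoN)
    (hSw : StrippingTailSwitchingConclTwoN) : StrippingTailWildConclTwoN := by
  intro p hp2 k K _ _ _ _ _ O A₀ h₀ t core hrk R P s hR0 hN hrun hnd hhigh h2 hinf hiso
  by_cases hx : ∃ i₀ : ℕ, ∃ x : K, x ≠ 0 ∧ x ∈ O ∧ O.valuation x < 1 ∧
      ∀ i, i₀ ≤ i → ∀ y ∈ R i, O.valuation y < 1 → ∃ j, i < j ∧ y / x ∈ R j
  · exact hP p hp2 k K O A₀ h₀ t core hrk R P s hR0 hN hrun hnd hhigh h2 hinf hiso hx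
  · exact hSw p hp2 k K O A₀ h₀ t core hrk R P s hR0 hN hrun hnd hhigh h2 hinf hiso hx


/-! ##### §σ2.27b — slate9 CANDIDATE (only if plan-1 adopts the (Par) fork of §σ2.27 (2); tri-1 11:03:48Z confirmed the interface) -/

/-- **T-LINE CANDIDATE slate9 (r36, conditional on plan-1 adopting the (Par) fork)** — slate8 with F-B-wild SPLIT:
`hFBw` ↦ (Par-P) `hFBp : StrippingTailPersistentConclTwoN` (WORK: res-type-062 g15 / tri-1 bricks, RULING 101) ∧ (Par-S)
`hFBs : StrippingTailSwitchingConclTwoN` (FRONTIER: the exceptional parameter switches i.o.; idea-1 g8 K4, tri-1 v1.6.1 A6 word `A B^{k₁} A B^{k₂} …`,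
`k_r ≥ 2` i.o.). 13 binders: FRONTIER {F-A1 `hB₂` · F-A2 `hC₂` · (Par-S) `hFBs` · G-TAME(4)₂ `hG4` · W(3)₂ `hW3`} · RUNG {G-perf(3)₂ `hG3`} ·
WORK {Θ♮ `hΘ` (pv-011, RULING 100) · (Par-P) `hFBp` (062 g15) · Θ1♭H+(L7) `hA3` (pv-003 + pv-004) · D3a `hD3a` (pv-012 + stub-3 + 096) · D3c `hD3c` ✓ (062
`lowTowerTamingTwo_holds`)} · FACTS {hL', hCP'}. Pure logic. OURS. [folklore] -/
theorem eternalSteeredRunTwo_of_slate9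
    (hΘ : PointTailChainTwoN) (hFBp : StrippingTailPersistentConclTwoN) (hFBs : StrippingTailSwitchingConclTwoN)
    (hB₂ : BirthWanderHighConclTwoN) (hC₂ : BranchWanderHighConclTwoN)
    (hA3 : StrippedThreadTwoNH)
    (hG4 : ∀ e : ℕ, 2 ≤ e → NoEternalConstOrderIsolatedChainPerfect 2 4 (2 * e))
    (hG3 : ∀ e : ℕ, 2 ≤ e → NoEternalConstOrderIsolatedChainPerfect 2 3 (2 * e))
    (hW3 : ∀ e : ℕ, 2 ≤ e → NoEternalConstOrderIsolatedChainImperfect 2 3 (2 * e))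
    (hD3a : LowTowerExistsTwo) (hD3c : LowTowerTamingTwo)
    (hL' : Literature.AlgebraicGeometry.Resolution.Lipman1978NoEternalNormalisedBranch.{0})
    (hCP' : Literature.AlgebraicGeometry.Resolution.CossartPiltant2019LocalPermissible.{0}) : EternalSteeredRunTwo :=
  eternalSteeredRunTwo_of_slate8 hΘ (strippingTailWildConclTwoN_of_persistence_fork hFBp hFBs) hB₂ hC₂ hA3 hG4 hG3 hW3
    hD3a hD3c hL' hCP'


/-- **THE T-LINE OF RECORD (r36)** — res-L0-w41-strat-2's `eternalSteeredRunTwo_of_slate9` (§σ2.27 v1.2: FRONTIER/RUNG binders at `p = 2`,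
the (Par) persistence fork of F-B-wild) with **hD3c `LowTowerTamingTwo` FED BY NAME** (res-type-062 `lowTowerTamingTwo_holds`, RULING 92):
T ⇐ FRONTIER {F-A1 `hB₂`, F-A2 `hC₂`, (Par-S) `hFBs`, G-TAME(4)₂ `hG4`, W(3)₂ `hW3`} · RUNG {G-perf(3)₂ `hG3`} · WORK {Θ♮ `hΘ` (res-D-pv-011),
(Par-P) `hFBp` (res-type-062 g15), Θ1♭+H `hA3` (res-D-pv-003 + (L7) res-D-pv-004), D3a `hD3a` (res-D-pv-012)} · FACTS {hL′ Lipman 1978 (A), hCP′}.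
12 binders. Pure logic. OURS. [folklore] -/
theorem eternalSteeredRunTwo_of_slate9'
    (hΘ : PointTailChainTwoN) (hFBp : StrippingTailPersistentConclTwoN) (hFBs : StrippingTailSwitchingConclTwoN)
    (hB₂ : BirthWanderHighConclTwoN) (hC₂ : BranchWanderHighConclTwoN)
    (hA3 : StrippedThreadTwoNH)
    (hG4 : ∀ e : ℕ, 2 ≤ e → NoEternalConstOrderIsolatedChainPerfect 2 4 (2 * e))
    (hG3 : ∀ e : ℕ, 2 ≤ e → NoEternalConstOrderIsolatedChainPerfect 2 3 (2 * e))
    (hW3 : ∀ e : ℕ, 2 ≤ e → NoEternalConstOrderIsolatedChainImperfect 2 3 (2 * e))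
    (hD3a : LowTowerExistsTwo)
    (hL' : Literature.AlgebraicGeometry.Resolution.Lipman1978NoEternalNormalisedBranch.{0})
    (hCP' : Literature.AlgebraicGeometry.Resolution.CossartPiltant2019LocalPermissible.{0}) : EternalSteeredRunTwo :=
  eternalSteeredRunTwo_of_slate9 hΘ hFBp hFBs hB₂ hC₂ hA3 hG4 hG3 hW3 hD3a lowTowerTamingTwo_holds hL' hCP'

/-- **(Par-P) LEAF** (res-type-062 g15; RULING 101 / 104a): the persistent-tail-parameter branch of F-B-wild closes the run —
for a core datum the weak persistence clause contradicts `¬ Discrete O` (tri-1's V-free squeeze `OddBranchVFree.discrete_of_persistent'`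
threaded through the steered tower by `OddBranchPersistence.concl_of_coreDatum_of_persistentTail_two`; only `CoreDatum`,
`¬ HasProperCoarsening O`, `R 0 = locAtCentre A₀ O`, the blow-up clauses of `IsSteeredRun` and the persistence clause are used).
OURS. [folklore] -/
theorem strippingTailPersistentConclTwoN_holds : StrippingTailPersistentConclTwoN := by
  intro p hp2 k K _ _ _ _ _ O A₀ h₀ t core hrk R P s hR0 _hN hrun _hnd _hhigh _h2 _hinf _hiso hx
  exact Summit.ResolutionOfSingularities.ResolutionOfSingularities.Theorems.SwitchingDichotomy.OddBranchPersistence.concl_of_coreDatum_of_persistentTail_two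
    p hp2 O A₀ h₀ t core hrk R P hR0 (fun i => by obtain ⟨_, _, -, h, -⟩ := hrun.2 i; exact h) hx


/-- **THE T-LINE OF RECORD (r37)** — `eternalSteeredRunTwo_of_slate9` with THREE WORK binders FED BY NAME: hFBp (Par-P)
`strippingTailPersistentConclTwoN_holds` (res-type-062 g15, p526908 + p528129), hA3 `strippedThreadTwoNH_holds` (res-D-pv-003 Θ1♭ engine +
res-D-pv-004 / res-L0-w41-stub-4 (L7)), hD3c `lowTowerTamingTwo_holds` (res-type-062 g14):
T ⇐ FRONTIER {F-A1 `hB₂`, F-A2 `hC₂`, (Par-S) `hFBs`, G-TAME(4)₂ `hG4`, W(3)₂ `hW3`} · RUNG {G-perf(3)₂ `hG3`} · WORK {Θ♮ `hΘ` (res-D-pv-011),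
D3a `hD3a` (res-D-pv-012)} · FACTS {hL′ Lipman 1978 (A), hCP′ CP 2019}. 10 binders. Pure logic. OURS. [folklore] -/
theorem eternalSteeredRunTwo_of_slate9''
    (hΘ : PointTailChainTwoN) (hFBs : StrippingTailSwitchingConclTwoN)
    (hB₂ : BirthWanderHighConclTwoN) (hC₂ : BranchWanderHighConclTwoN)
    (hG4 : ∀ e : ℕ, 2 ≤ e → NoEternalConstOrderIsolatedChainPerfect 2 4 (2 * e))
    (hG3 : ∀ e : ℕ, 2 ≤ e → NoEternalConstOrderIsolatedChainPerfect 2 3 (2 * e))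
    (hW3 : ∀ e : ℕ, 2 ≤ e → NoEternalConstOrderIsolatedChainImperfect 2 3 (2 * e))
    (hD3a : LowTowerExistsTwo)
    (hL' : Literature.AlgebraicGeometry.Resolution.Lipman1978NoEternalNormalisedBranch.{0})
    (hCP' : Literature.AlgebraicGeometry.Resolution.CossartPiltant2019LocalPermissible.{0}) : EternalSteeredRunTwo :=
  eternalSteeredRunTwo_of_slate9' hΘ strippingTailPersistentConclTwoN_holds hFBs hB₂ hC₂ strippedThreadTwoNH_holds hG4 hG3 hW3
    hD3a hL' hCP'


end SteeredTwo

end Summit.ResolutionOfSingularities.ResolutionOfSingularities.Theorems.SwitchingDichotomy.Words
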